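import Summits.AtomisticToContinuum.Crystallization.Theorems.FrustratedLawDichotomyStrainedPatchHomLeafTableSumsP
import Summits.AtomisticToContinuum.Crystallization.Theorems.FrustratedLawDichotomyStrainedPatchHomLeafPointsParam
import Summits.AtomisticToContinuum.Crystallization.Theorems.FrustratedLawDichotomyStrainedPatchHomEntryGram

/-!
# Param-form leaf — REAL READINGS: off-sums, the exact Jacobian of the frame Gram map, the parametrised Gram enclosure, radius and rounding bounds

decomp-a2c hand-1 g23 (crux `AperiodicFrustratedLawGap`, stmt-AtomisticToContinuum-27623; critic row 882).  Analysis-free algebra for the soundness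
of `leafCheckP` (`…HomLeafTableCheckP`): with `u_ab = (U e_b)_a`, centre `c_ab/SC`, `δ = u − c/SC`, off-sums `O_ia = Σ_{b≠i} c_ab/SC`,
`Δ_ia = Σ_{b≠i} δ_ab`: `⟪U fᵢ, U fⱼ⟫ = ½Σ_a O_ia O_ja + Σ_ab J_{ab,ij} δ_ab + ½Σ_a Δ_ia Δ_ja` with the EXACT Jacobian
`J_{ab,ij} = ½(O_ia [b≠j] + O_ja [b≠i])` (★ `gram_param_decomp`); the label functional pulled back through `J` is `(P_a/SC)·n_b`
(★ `sum_lab_Jf`); the floored centre `cG` and the remainder `rhoP` enclose the constant and quadratic parts (★ `gram_paramP`).  Small proof-side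
real-valued definitions (`uE`, `OfR`, `Jf`, `nLab`); 0 sorry; standard axioms.  `--supports stmt-AtomisticToContinuum-27623`.
-/

noncomputable section

namespace Summit.AtomisticToContinuum.Crystallization.Theorems.FrustratedLawDichotomyStrainedPatchHomLeafTableCheck

open scoped BigOperators RealInnerProductSpace
open Literature.Analysis.ValidatedNumerics.Numerics
open Summit.AtomisticToContinuum.Crystallization.Theorems.ChargedEnergyGapNegative (E3)
open Summit.AtomisticToContinuum.Crystallization.Theorems.FrustratedLawDichotomyStrainedPatchHomEntryGram (inner_map_fccVec_eq)
open Literature.Barriers.AtomisticToContinuum.FlatleyTheil2015 (fccVec)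

/-! ## §1. Entries and off-sums -/

/-- The entry `u_ab = (U e_b)_a`. -/
def uE (U : E3 →L[ℝ] E3) (ab : Fin 3 × Fin 3) : ℝ := (U (EuclideanSpace.single ab.2 (1 : ℝ))) ab.1

/-- Real off-sum of row `a` off column `i` (shape of `offS` / `offSumFI`). -/
def OfR (u : Fin 3 × Fin 3 → ℝ) (i a : Fin 3) : ℝ :=
  if i = 0 then u (a, 1) + u (a, 2) else if i = 1 then u (a, 0) + u (a, 2) else u (a, 0) + u (a, 1)

/-- `OfR` is additive. [formal bookkeeping] -/
theorem OfR_add (u v : Fin 3 × Fin 3 → ℝ) (i a : Fin 3) : OfR (fun ab => u ab + v ab) i a = OfR u i a + OfR v i a := by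
  unfold OfR; split_ifs <;> ring

/-- `OfR` of a difference. [formal bookkeeping] -/
theorem OfR_sub (u v : Fin 3 × Fin 3 → ℝ) (i a : Fin 3) : OfR (fun ab => u ab - v ab) i a = OfR u i a - OfR v i a := by
  unfold OfR; split_ifs <;> ring

/-- `|OfR u| ≤ OfR W` when `|u| ≤ W` entrywise. [formal bookkeeping] -/
theorem abs_OfR_le {u W : Fin 3 × Fin 3 → ℝ} (h : ∀ ab, |u ab| ≤ W ab) (i a : Fin 3) : |OfR u i a| ≤ OfR W i a := by
  unfold OfR; split_ifs <;> exact (abs_add_le _ _).trans (add_le_add (h _) (h _))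

/-- `0 ≤ OfR W` when `0 ≤ W`. [formal bookkeeping] -/
theorem OfR_nonneg {W : Fin 3 × Fin 3 → ℝ} (h : ∀ ab, 0 ≤ W ab) (i a : Fin 3) : 0 ≤ OfR W i a := by
  unfold OfR; split_ifs <;> exact add_nonneg (h _) (h _)

/-- The integer off-sum `offS` read in `ℝ`. [formal bookkeeping] -/
theorem offS_cast (c : Fin 3 × Fin 3 → ℤ) (i a : Fin 3) : ((offS c i a : ℤ) : ℝ) = OfR (fun ab => (c ab : ℝ)) i a := by
  unfold offS OfR; split_ifs <;> push_cast <;> rfl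

/-- The natural off-sum `offW` read in `ℝ` (non-negative widths). [formal bookkeeping] -/
theorem offW_cast {w : Fin 3 × Fin 3 → ℤ} (hw : ∀ ab, 0 ≤ w ab) (i a : Fin 3) : ((offW w i a : ℕ) : ℝ) = OfR (fun ab => (w ab : ℝ)) i a := by
  have e : ∀ ab, (((w ab).toNat : ℕ) : ℝ) = ((w ab : ℤ) : ℝ) := fun ab => by exact_mod_cast Int.toNat_of_nonneg (hw ab)
  unfold offW OfR; split_ifs <;> push_cast <;> simp only [e]

/-- `Σ_b u_ab − u_ai = OfR u i a`. [formal bookkeeping] -/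
theorem sum_sub_eq_OfR (u : Fin 3 × Fin 3 → ℝ) (i a : Fin 3) : (∑ b : Fin 3, u (a, b)) - u (a, i) = OfR u i a := by
  fin_cases i <;> simp [OfR, Fin.sum_univ_three] <;> ring

/-- ★ `⟪U fᵢ, U fⱼ⟫ = ½ Σ_a OfR u i a · OfR u j a` (fcc frame, `u = uE U`). [folklore] -/
theorem inner_fcc_eq_OfR (U : E3 →L[ℝ] E3) (i j : Fin 3) :
    ⟪U (fccVec i), U (fccVec j)⟫ = (∑ a : Fin 3, OfR (uE U) i a * OfR (uE U) j a) / 2 := by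
  rw [inner_map_fccVec_eq]
  congr 1
  refine Finset.sum_congr rfl fun a _ => ?_
  rw [← sum_sub_eq_OfR (uE U) i a, ← sum_sub_eq_OfR (uE U) j a]
  rfl

/-! ## §2. The exact Jacobian and the pulled-back label functional -/

/-- The Jacobian of `(i,j) ↦ ½Σ_a O_ia O_ja` in the direction of entry `(a,b)`: `½(O_ia [b≠j] + O_ja [b≠i])`. -/
def Jf (O : Fin 3 → Fin 3 → ℝ) (ab ij : Fin 3 × Fin 3) : ℝ :=
  (O ij.1 ab.1 * (if ab.2 = ij.2 then 0 else 1) + O ij.2 ab.1 * (if ab.2 = ij.1 then 0 else 1)) / 2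

/-- `Σ_ab J_{ab,ij} δ_ab = ½ Σ_a (O_ia Δ_ja + O_ja Δ_ia)`. [formal bookkeeping] -/
theorem sum_Jf_mul (O : Fin 3 → Fin 3 → ℝ) (δ : Fin 3 × Fin 3 → ℝ) (i j : Fin 3) :
    ∑ a : Fin 3, ∑ b : Fin 3, Jf O (a, b) (i, j) * δ (a, b) = (∑ a : Fin 3, (O i a * OfR δ j a + O j a * OfR δ i a)) / 2 := by
  fin_cases i <;> fin_cases j <;> simp [Jf, OfR, Fin.sum_univ_three] <;> ring

/-- ★ **THE PARAMETRISED GRAM IDENTITY** (exact, `G` quadratic): `⟪U fᵢ, U fⱼ⟫ − ½Σ_a O_ia O_ja − Σ_ab J_{ab,ij} δ_ab = ½ Σ_a Δ_ia Δ_ja`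
with `O = OfR uC`, `δ = uE U − uC`, `Δ = OfR δ`, for ANY centre `uC`. [folklore] -/
theorem gram_param_decomp (U : E3 →L[ℝ] E3) (uC : Fin 3 × Fin 3 → ℝ) (i j : Fin 3) :
    ⟪U (fccVec i), U (fccVec j)⟫ - (∑ a : Fin 3, OfR uC i a * OfR uC j a) / 2 -
        ∑ a : Fin 3, ∑ b : Fin 3, Jf (OfR uC) (a, b) (i, j) * (uE U (a, b) - uC (a, b)) =
      (∑ a : Fin 3, OfR (fun ab => uE U ab - uC ab) i a * OfR (fun ab => uE U ab - uC ab) j a) / 2 := by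
  have h2 := sum_Jf_mul (OfR uC) (fun ab => uE U ab - uC ab) i j
  rw [inner_fcc_eq_OfR, h2]
  have hX : ∀ i' a, OfR (uE U) i' a = OfR uC i' a + OfR (fun ab => uE U ab - uC ab) i' a := by
    intro i' a; rw [OfR_sub]; ring
  simp only [hX, Fin.sum_univ_three]
  ring

/-- The label's `n`-vector: `n_c = Σ_{j ≠ c} b_j`. -/
def nLab (b : Fin 3 → ℤ) (c : Fin 3) : ℤ := if c = 0 then b 1 + b 2 else if c = 1 then b 0 + b 2 else b 0 + b 1

/-- ★ **THE LABEL FUNCTIONAL PULLED BACK**: `Σ_ij bᵢbⱼ J_{(a,bb),ij} = (Σ_c uC_ac n_c) · n_bb`. [formal bookkeeping] -/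
theorem sum_lab_Jf (b : Fin 3 → ℤ) (uC : Fin 3 × Fin 3 → ℝ) (a bb : Fin 3) :
    ∑ i : Fin 3, ∑ j : Fin 3, ((b i : ℝ) * (b j : ℝ)) * Jf (OfR uC) (a, bb) (i, j) =
      (∑ c : Fin 3, uC (a, c) * (nLab b c : ℝ)) * (nLab b bb : ℝ) := by
  fin_cases bb <;> simp [Jf, OfR, nLab, Fin.sum_univ_three] <;> ring

/-- The record's `n0/n1/n2` are `nLab` of its label. [formal bookkeeping] -/
theorem nLab_toLab (l : NL) : nLab l.toLab 0 = n0 l ∧ nLab l.toLab 1 = n1 l ∧ nLab l.toLab 2 = n2 l := by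
  simp [nLab, NL.toLab, n0, n1, n2]

/-- The record's `P0/P1/P2` against `epOf c w` are `SC·Σ_c uC_ac n_c`. [formal bookkeeping] -/
theorem P_cast (c w : Fin 3 × Fin 3 → ℤ) (l : NL) :
    ((P0 (epOf c w) l : ℤ) : ℝ) = ∑ cc : Fin 3, (c (0, cc) : ℝ) * (nLab l.toLab cc : ℝ) ∧
    ((P1 (epOf c w) l : ℤ) : ℝ) = ∑ cc : Fin 3, (c (1, cc) : ℝ) * (nLab l.toLab cc : ℝ) ∧
    ((P2 (epOf c w) l : ℤ) : ℝ) = ∑ cc : Fin 3, (c (2, cc) : ℝ) * (nLab l.toLab cc : ℝ) := by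
  simp only [P0, P1, P2, epOf, Fin.sum_univ_three, nLab, NL.toLab, n0, n1, n2, Int.add_def, Int.mul_def]
  push_cast
  simp

/-! ## §3. Rounding bounds -/

/-- Euclidean integer division in `ℝ`: `⌊N/D⌋ ≤ N/D < ⌊N/D⌋ + 1` (`D > 0`). [formal bookkeeping] -/
theorem int_ediv_real {N D : ℤ} (hD : 0 < D) : ((N / D : ℤ) : ℝ) ≤ (N : ℝ) / D ∧ (N : ℝ) / D < ((N / D : ℤ) : ℝ) + 1 := by
  have hDr : (0 : ℝ) < D := by exact_mod_cast hD
  have h1 := Int.emod_nonneg N hD.ne'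
  have h2 := Int.emod_lt_of_pos N hD
  have h3 := Int.mul_ediv_add_emod N D
  have e : (N : ℝ) = D * ((N / D : ℤ) : ℝ) + ((N % D : ℤ) : ℝ) := by exact_mod_cast h3.symm
  constructor
  · rw [le_div_iff₀ hDr, e]
    have : (0:ℝ) ≤ ((N % D : ℤ) : ℝ) := by exact_mod_cast h1
    nlinarith
  · rw [div_lt_iff₀ hDr, e]
    have : ((N % D : ℤ) : ℝ) < D := by exact_mod_cast h2
    nlinarith

/-- Natural ceiling division: `X/D ≤ ⌈X/D⌉ = (X + (D−1))/D`. [formal bookkeeping] -/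
theorem nat_ceil_div (X : ℕ) {D : ℕ} (hD : 0 < D) : (X : ℝ) / D ≤ (((X + (D - 1)) / D : ℕ) : ℝ) := by
  have hDr : (0 : ℝ) < D := by exact_mod_cast hD
  rw [div_le_iff₀ hDr]
  have h := Nat.lt_div_mul_add (a := X + (D - 1)) hD
  have : X ≤ (X + (D - 1)) / D * D := by omega
  exact_mod_cast this

/-- The floored Gram centre is within `1/SC` below the exact centre: `0 ≤ ½Σ_a O_ia O_ja − cG/SC ≤ 1/SC` (`O = OfR (c/SC)`). [folklore] -/
theorem cG_bound (c : Fin 3 × Fin 3 → ℤ) (i j : Fin 3) :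
    0 ≤ (∑ a : Fin 3, OfR (fun ab => (c ab : ℝ) / SC) i a * OfR (fun ab => (c ab : ℝ) / SC) j a) / 2 - ((cG c i j : ℤ) : ℝ) / SC ∧
    (∑ a : Fin 3, OfR (fun ab => (c ab : ℝ) / SC) i a * OfR (fun ab => (c ab : ℝ) / SC) j a) / 2 - ((cG c i j : ℤ) : ℝ) / SC ≤ 1 / SC := by
  have hS := SC_pos
  have hO : ∀ i' a, OfR (fun ab => (c ab : ℝ) / SC) i' a = ((offS c i' a : ℤ) : ℝ) / SC := by
    intro i' a; rw [offS_cast]; unfold OfR; split_ifs <;> ring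
  simp only [hO]
  set N : ℤ := offS c i 0 * offS c j 0 + offS c i 1 * offS c j 1 + offS c i 2 * offS c j 2 with hN
  have hD : (0 : ℤ) < 2 * (SC : ℤ) := by norm_num [SC]
  have hb := int_ediv_real (N := N) hD
  have hcG : cG c i j = N / (2 * (SC : ℤ)) := rfl
  rw [hcG]
  have e : (∑ a : Fin 3, ((offS c i a : ℤ) : ℝ) / SC * (((offS c j a : ℤ) : ℝ) / SC)) / 2 = ((N : ℝ) / (2 * (SC : ℝ))) / SC := by
    simp only [hN, Fin.sum_univ_three]; push_cast; field_simp
  rw [e]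
  have e2 : (((2 * (SC : ℤ) : ℤ)) : ℝ) = 2 * (SC : ℝ) := by push_cast; ring
  rw [e2] at hb
  constructor
  · rw [← sub_div]; exact div_nonneg (by linarith [hb.1]) hS.le
  · rw [← sub_div]; exact div_le_div_of_nonneg_right (by linarith [hb.2]) hS.le

/-- The remainder class dominates the quadratic term plus the centre rounding: `1/SC + ½Σ_a W_ia W_ja/SC² ≤ rhoP/SC`. [folklore] -/
theorem rhoP_bound {w : Fin 3 × Fin 3 → ℤ} (hw : ∀ ab, 0 ≤ w ab) (i j : Fin 3) :
    1 / SC + (∑ a : Fin 3, OfR (fun ab => (w ab : ℝ) / SC) i a * OfR (fun ab => (w ab : ℝ) / SC) j a) / 2 ≤ ((rhoP w i j : ℕ) : ℝ) / SC := by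
  have hS := SC_pos
  have hO : ∀ i' a, OfR (fun ab => (w ab : ℝ) / SC) i' a = ((offW w i' a : ℕ) : ℝ) / SC := by
    intro i' a; rw [offW_cast hw]; unfold OfR; split_ifs <;> ring
  simp only [hO]
  set N : ℕ := offW w i 0 * offW w j 0 + offW w i 1 * offW w j 1 + offW w i 2 * offW w j 2 with hN
  have hrho : rhoP w i j = N / (2 * SCN) + 2 := rfl
  have hD : (0 : ℤ) < ((2 * SCN : ℕ) : ℤ) := by rw [SCN_eq]; norm_num [SC]
  have hb := (int_ediv_real (N := (N : ℤ)) hD).2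
  have ediv : (((N : ℤ) / ((2 * SCN : ℕ) : ℤ) : ℤ) : ℝ) = (((N / (2 * SCN) : ℕ) : ℤ) : ℝ) := by norm_cast
  rw [ediv] at hb
  rw [hrho]
  have hS2 : ((2 * SCN : ℕ) : ℝ) = 2 * (SC : ℝ) := by rw [SCN_eq]; push_cast; ring
  have e : (∑ a : Fin 3, ((offW w i a : ℕ) : ℝ) / SC * (((offW w j a : ℕ) : ℝ) / SC)) / 2 = ((N : ℝ) / (2 * (SC : ℝ))) / SC := by
    simp only [hN, Fin.sum_univ_three]; push_cast; field_simp
  rw [e, ← add_div]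
  refine div_le_div_of_nonneg_right ?_ hS.le
  have hb' : (N : ℝ) / (2 * (SC : ℝ)) < ((N / (2 * SCN) : ℕ) : ℝ) + 1 := by
    have : ((N : ℤ) : ℝ) / (((2 * SCN : ℕ) : ℤ) : ℝ) = (N : ℝ) / (2 * (SC : ℝ)) := by rw [← hS2]; push_cast; rfl
    rw [this] at hb; exact_mod_cast hb
  push_cast
  linarith

/-! ## §4. The parametrised Gram enclosure -/

/-- Non-negativity of the half-widths from the box hypothesis. [formal bookkeeping] -/
theorem w_nonneg_of_hbox {U : E3 →L[ℝ] E3} {c w : Fin 3 × Fin 3 → ℤ}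
    (hbox : ∀ ab : Fin 3 × Fin 3, |(U (EuclideanSpace.single ab.2 (1 : ℝ))) ab.1 - (c ab : ℝ) / SC| ≤ (w ab : ℝ) / SC) (ab : Fin 3 × Fin 3) :
    0 ≤ w ab := by
  have hS := SC_pos
  have h := (abs_nonneg _).trans (hbox ab)
  have : (0 : ℝ) ≤ (w ab : ℝ) := by
    by_contra hneg; push Not at hneg
    have := div_neg_of_neg_of_pos hneg hS; linarith
  exact_mod_cast this

/-- ★★ **THE PARAMETRISED GRAM ENCLOSURE**: `|⟪U fᵢ, U fⱼ⟫ − cG_ij/SC − Σ_ab J_{ab,ij} δ_ab| ≤ rhoP_ij/SC` for every `U` with entries in the box. [folklore] -/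
theorem gram_paramP (U : E3 →L[ℝ] E3) {c w : Fin 3 × Fin 3 → ℤ}
    (hbox : ∀ ab : Fin 3 × Fin 3, |(U (EuclideanSpace.single ab.2 (1 : ℝ))) ab.1 - (c ab : ℝ) / SC| ≤ (w ab : ℝ) / SC) (i j : Fin 3) :
    |⟪U (fccVec i), U (fccVec j)⟫ - ((cG c i j : ℤ) : ℝ) / SC -
        ∑ a : Fin 3, ∑ b : Fin 3, Jf (OfR (fun ab => (c ab : ℝ) / SC)) (a, b) (i, j) * (uE U (a, b) - (c (a, b) : ℝ) / SC)| ≤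
      ((rhoP w i j : ℕ) : ℝ) / SC := by
  have hS := SC_pos
  have hw := w_nonneg_of_hbox hbox
  have hd := gram_param_decomp U (fun ab => (c ab : ℝ) / SC) i j
  have hc := cG_bound c i j
  have hρ := rhoP_bound hw i j
  -- the quadratic term
  have hΔ : ∀ i' a, |OfR (fun ab => uE U ab - (c ab : ℝ) / SC) i' a| ≤ OfR (fun ab => (w ab : ℝ) / SC) i' a :=
    fun i' a => abs_OfR_le (fun ab => hbox ab) i' a
  have hW0 : ∀ i' a, 0 ≤ OfR (fun ab => (w ab : ℝ) / SC) i' a :=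
    fun i' a => OfR_nonneg (fun ab => div_nonneg (by exact_mod_cast hw ab) hS.le) i' a
  have hquad : |(∑ a : Fin 3, OfR (fun ab => uE U ab - (c ab : ℝ) / SC) i a * OfR (fun ab => uE U ab - (c ab : ℝ) / SC) j a) / 2| ≤
      (∑ a : Fin 3, OfR (fun ab => (w ab : ℝ) / SC) i a * OfR (fun ab => (w ab : ℝ) / SC) j a) / 2 := by
    rw [abs_div, abs_two]
    refine div_le_div_of_nonneg_right ((Finset.abs_sum_le_sum_abs _ _).trans (Finset.sum_le_sum fun a _ => ?_)) zero_le_two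
    rw [abs_mul]
    exact mul_le_mul (hΔ i a) (hΔ j a) (abs_nonneg _) (hW0 i a)
  -- assemble: (G − cG/SC − ΣJδ) = (½ΣOO − cG/SC) + ½ΣΔΔ
  have key : ⟪U (fccVec i), U (fccVec j)⟫ - ((cG c i j : ℤ) : ℝ) / SC -
      ∑ a : Fin 3, ∑ b : Fin 3, Jf (OfR (fun ab => (c ab : ℝ) / SC)) (a, b) (i, j) * (uE U (a, b) - (c (a, b) : ℝ) / SC) =
      ((∑ a : Fin 3, OfR (fun ab => (c ab : ℝ) / SC) i a * OfR (fun ab => (c ab : ℝ) / SC) j a) / 2 - ((cG c i j : ℤ) : ℝ) / SC) +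
      (∑ a : Fin 3, OfR (fun ab => uE U ab - (c ab : ℝ) / SC) i a * OfR (fun ab => uE U ab - (c ab : ℝ) / SC) j a) / 2 := by
    linarith [hd]
  rw [key]
  refine (abs_add_le _ _).trans ?_
  rw [abs_of_nonneg hc.1]
  linarith [hc.2, hquad, hρ]

end Summit.AtomisticToContinuum.Crystallization.Theorems.FrustratedLawDichotomyStrainedPatchHomLeafTableCheck

end
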